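import Summits.BirchSwinnertonDyer.Rank1Residual.ManinAdditive.UDCKummerWitnessLine
import Summits.BirchSwinnertonDyer.BirchSwinnertonDyer.Theorems.ManinLocalTwoThreeKummerCubeRootSigmaAutomorphy
import Literature.NumberTheory.EllipticCurves.ModularCurveKleinJ
import HarnessLib

/-!
# (INV-a) `Γ₀(N)`-transformation of the minimal Kummer block and of the integer pole killer
(route `ManinLocalTwoThree`, crux C3 `ManinPrimeToThreeAtNine` stmt-BirchSwinnertonDyer-22968; cell bsd-f2-manin, p2 gen 17;
`--supports stmt-BirchSwinnertonDyer-22968`; first file toward -an g38's typed piece (INV) `UDCKummerWitnessLine.KummerMinimalWitnessInvariance`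
of the witness law `stub_kummerCubeRootModularFormWitness` (p729921))

For the witness `F = C₀·kummerMinBlock D u e·kummerPoleKiller P n` of `UDCKummerWitnessLine`:
* `shortX_gamma_smul`, `shortY_gamma_smul`, `minimalY_gamma_smul`, `minimalParam_gamma_smul` — the short-model coordinates and the minimal
  parameter `t_W∘φ` are `Γ₀(N)`-INVARIANT (`w(γτ) = w(τ) + μ_γ`, `μ_γ = c·{∞,γ∞}_f ∈ Λ`, `℘, ℘′` periodic);
* `kummerMinBlock_gamma_smul_of_multiplier` — `block(γτ) = ρ·block(τ)` for any multiplier `ρ` of `W_{u,e}` along `μ_γ` (all `τ`, junk values included);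
* `kummerPoleKiller_gamma_smul` — `(Δ^{deg P}P(j))ⁿ(gτ) = (cτ+d)^{12·n·deg P}·(Δ^{deg P}P(j))ⁿ(τ)` for EVERY `g ∈ SL(2, ℤ)` (tree
  `levelOne_apply_smul`, `discriminant_apply_smul`);
* `smul_eichlerIntegral_notMem_iff` (the good set is `Γ₀(N)`-stable) and **`slash_apply_eq_mul_of_good`**: on the good set
  `{w ∉ Λ, minimalY ≠ 0}` where `F` is given by the formula, `(F ∣[12·n·deg P] γ)(τ) = ρ·F(τ)`.
HONEST FRAMING.  Bookkeeping; the density of the good set and the iff `KummerPeriodTrivial ⟺ F ∣ γ = F` follow in the sequel files.  BSD is not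
proved by this; Manin's conjecture is not proved; C2 and C3 remain OPEN.
[folklore]
-/

set_option autoImplicit false
-- lint-debt: the directory name repeats the summit name (sibling precedent `ManinLocalTwoThreeKummerCubeRootSigmaAutomorphy.lean`)
set_option linter.dupNamespace false

noncomputable section

open scoped Topology PeriodPair MatrixGroups Manifold ModularForm
open Complex Filter CongruenceSubgroup
open UpperHalfPlane hiding I
open Literature.NumberTheory.EllipticCurves Literature.NumberTheory.EllipticCurves.ModularForms
open Summit.BirchSwinnertonDyer.Rank1Residual.ManinAdditive.KummerCubeMonodromy
open Summit.BirchSwinnertonDyer.Rank1Residual.ManinAdditive.UDCKummerWitnessLine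
open Summit.BirchSwinnertonDyer.BirchSwinnertonDyer.Theorems.ManinLocalTwoThree.KummerCubeRootDictionary

namespace Summit.BirchSwinnertonDyer.BirchSwinnertonDyer.Theorems.ManinLocalTwoThree.WitnessInvariance

variable {W : WeierstrassCurve ℚ} {N : ℕ} [NeZero N]

/-! ### §1 The short-model coordinates and the minimal parameter are `Γ₀(N)`-invariant -/

/-- `x_s(γτ) = x_s(τ)` (`℘` is `Λ`-periodic, `μ_γ ∈ Λ`). [folklore] -/
theorem shortX_gamma_smul (D : ModularParametrizationData W N) (γ : Gamma0 N) (τ : ℍ) :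
    shortX D ((γ : SL(2, ℤ)) • τ) = shortX D τ := by
  have hμ := smul_cuspSymbol_mem_lattice D γ
  rw [shortX, shortX, smul_eichlerIntegral_gamma_smul,
    show (D.c : ℂ) * cuspSymbol D.f γ = ((⟨_, hμ⟩ : D.L.lattice) : ℂ) from rfl, PeriodPair.weierstrassP_add_coe]

/-- `y_s(γτ) = y_s(τ)` (`℘′` is `Λ`-periodic). [folklore] -/
theorem shortY_gamma_smul (D : ModularParametrizationData W N) (γ : Gamma0 N) (τ : ℍ) :
    shortY D ((γ : SL(2, ℤ)) • τ) = shortY D τ := by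
  have hμ := smul_cuspSymbol_mem_lattice D γ
  rw [shortY, shortY, smul_eichlerIntegral_gamma_smul,
    show (D.c : ℂ) * cuspSymbol D.f γ = ((⟨_, hμ⟩ : D.L.lattice) : ℂ) from rfl, PeriodPair.derivWeierstrassP_add_coe]

/-- `c³·(y_W∘φ)` is `Γ₀(N)`-invariant. [folklore] -/
theorem minimalY_gamma_smul (D : ModularParametrizationData W N) (γ : Gamma0 N) (τ : ℍ) :
    minimalY D ((γ : SL(2, ℤ)) • τ) = minimalY D τ := by
  rw [minimalY, minimalY, shortX_gamma_smul, shortY_gamma_smul]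

/-- `t_W∘φ` is `Γ₀(N)`-invariant. [folklore] -/
theorem minimalParam_gamma_smul (D : ModularParametrizationData W N) (γ : Gamma0 N) (τ : ℍ) :
    minimalParam D ((γ : SL(2, ℤ)) • τ) = minimalParam D τ := by
  rw [minimalParam, minimalParam, shortX_gamma_smul, minimalY_gamma_smul]

/-- The good set `{w ∉ Λ}` is `Γ₀(N)`-stable: `w(γτ) ∉ Λ ⟺ w(τ) ∉ Λ`. [folklore] -/
theorem smul_eichlerIntegral_notMem_iff (D : ModularParametrizationData W N) (γ : Gamma0 N) (τ : ℍ) :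
    (D.c : ℂ) * eichlerIntegral D.f ((γ : SL(2, ℤ)) • τ) ∉ D.L.lattice ↔ (D.c : ℂ) * eichlerIntegral D.f τ ∉ D.L.lattice := by
  have hμ := smul_cuspSymbol_mem_lattice D γ
  rw [smul_eichlerIntegral_gamma_smul, not_iff_not]
  constructor
  · intro h; simpa using D.L.lattice.sub_mem h hμ
  · intro h; exact D.L.lattice.add_mem h hμ

/-! ### §2 The block picks up the multiplier of `W_{u,e}`, the killer the automorphy factor -/

/-- **`block(γτ) = ρ·block(τ)`** for any multiplier `ρ` of `W_{u,e}` along `μ_γ = c·{∞,γ∞}_f`. [folklore] -/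
theorem kummerMinBlock_gamma_smul_of_multiplier (D : ModularParametrizationData W N) (u e : ℂ) (γ : Gamma0 N) {ρ : ℂ}
    (hρ : ∀ w : ℂ, sigmaCubeRoot D.L u e (w + (D.c : ℂ) * cuspSymbol D.f γ) = ρ * sigmaCubeRoot D.L u e w) (τ : ℍ) :
    kummerMinBlock D u e ((γ : SL(2, ℤ)) • τ) = ρ * kummerMinBlock D u e τ := by
  rw [kummerMinBlock, kummerMinBlock, minimalParam_gamma_smul, smul_eichlerIntegral_gamma_smul, hρ]
  ring

/-- **`(Δ^{deg P}P(j))ⁿ(gτ) = (cτ + d)^{12·n·deg P}·(Δ^{deg P}P(j))ⁿ(τ)`** for every `g ∈ SL(2, ℤ)`: each monomial `E₄^{3i}Δ^{deg P − i}` is a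
level-one form of weight `12·deg P`. [cite: DiamondShurman2005, §1.2] -/
theorem kummerPoleKiller_gamma_smul (P : Polynomial ℤ) (n : ℕ) (g : SL(2, ℤ)) (τ : ℍ) :
    kummerPoleKiller P n (g • τ) = denom g τ ^ (12 * n * P.natDegree) * kummerPoleKiller P n τ := by
  unfold kummerPoleKiller
  have hE : ModularForm.E₄ (g • τ) = denom g τ ^ 4 * ModularForm.E₄ τ := by
    have := levelOne_apply_smul ModularForm.E₄ g τ
    rwa [zpow_ofNat] at this
  have hΔ : ModularForm.discriminant (g • τ) = denom g τ ^ 12 * ModularForm.discriminant τ := by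
    have := discriminant_apply_smul g τ
    rwa [zpow_ofNat] at this
  have key : ∀ i ∈ Finset.range (P.natDegree + 1),
      ((P.coeff i : ℤ) : ℂ) * ModularForm.E₄ (g • τ) ^ (3 * i) * ModularForm.discriminant (g • τ) ^ (P.natDegree - i) =
        denom g τ ^ (12 * P.natDegree) *
          (((P.coeff i : ℤ) : ℂ) * ModularForm.E₄ τ ^ (3 * i) * ModularForm.discriminant τ ^ (P.natDegree - i)) := by
    intro i hi
    obtain ⟨j, hj⟩ := Nat.exists_eq_add_of_le (Nat.lt_succ_iff.mp (Finset.mem_range.mp hi))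
    rw [hj, Nat.add_sub_cancel_left, hE, hΔ]
    ring
  rw [Finset.sum_congr rfl key, ← Finset.mul_sum, mul_pow, ← pow_mul, Nat.mul_right_comm]

/-! ### §3 The slash of the witness on the good set -/

/-- **On the good set, `(F ∣[12·n·deg P] γ)(τ) = ρ·F(τ)`** for a function `F` given there by `C₀·block·killer` and any multiplier `ρ` of
`W_{u,e}` along `μ_γ`. [folklore] -/
theorem slash_apply_eq_mul_of_good (D : ModularParametrizationData W N) (u e : ℂ) (P : Polynomial ℤ) (n : ℕ) (C₀ : ℂ)
    {F : ℍ → ℂ}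
    (hF : ∀ τ : ℍ, (D.c : ℂ) * eichlerIntegral D.f τ ∉ D.L.lattice → minimalY D τ ≠ 0 →
      F τ = C₀ * kummerMinBlock D u e τ * kummerPoleKiller P n τ)
    (γ : Gamma0 N) {ρ : ℂ} (hρ : ∀ w : ℂ, sigmaCubeRoot D.L u e (w + (D.c : ℂ) * cuspSymbol D.f γ) = ρ * sigmaCubeRoot D.L u e w)
    (τ : ℍ) (hw : (D.c : ℂ) * eichlerIntegral D.f τ ∉ D.L.lattice) (hY : minimalY D τ ≠ 0) :
    (F ∣[((12 * n * P.natDegree : ℕ) : ℤ)] (γ : SL(2, ℤ))) τ = ρ * F τ := by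
  rw [ModularForm.SL_slash_apply]
  have hw' : (D.c : ℂ) * eichlerIntegral D.f ((γ : SL(2, ℤ)) • τ) ∉ D.L.lattice := (smul_eichlerIntegral_notMem_iff D γ τ).mpr hw
  have hY' : minimalY D ((γ : SL(2, ℤ)) • τ) ≠ 0 := by rwa [minimalY_gamma_smul]
  have hd : denom (γ : SL(2, ℤ)) τ ^ (12 * n * P.natDegree) ≠ 0 := pow_ne_zero _ (denom_ne_zero _ τ)
  rw [hF _ hw' hY', hF τ hw hY, kummerMinBlock_gamma_smul_of_multiplier D u e γ hρ, kummerPoleKiller_gamma_smul,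
    zpow_neg, zpow_natCast]
  field_simp

end Summit.BirchSwinnertonDyer.BirchSwinnertonDyer.Theorems.ManinLocalTwoThree.WitnessInvariance

end
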